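/-
Copyright (c) 2026 the pub-hodgecm-mathlib formalisation cell (harness21).  Prover seat hodgecm-mathlib-F0P2-p11 (g2) (L1; LEAD F0P6-plan (g14) «(o1) KIND 1», memo
`CENSUS-K1-DealTable` ADDENDUM 2 route (c″)), Track B «K2-LIT» ∕ hLiu418 #184♮, ROAD Φ, G5-b: A SIEGEL SECTION BEHIND THE MIDDLE WEYL ELEMENT SEES ONLY THE CORNER
COORDINATE OF A UNIPOTENT — `f(w₀ · u · x) = f(w₀ · u' · x)` when `X(u)₁₁ = X(u')₁₁`.  THEOREMS ONLY.
-/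
import Summits.HodgeConjecture.HodgeConjecture.Theorems.K2LiuSiegelMiddleCellLeviCriterion     -- ★ `isSiegelDelta_reflStd_conj_levi_unip_iff`, `mul_self_of_coe_eq_signDiagonal`, `reflStd_inv`
import Summits.HodgeConjecture.HodgeConjecture.Theorems.K2LiuSiegelMiddleStabilizerCharacter   -- ★ `reflection_stabilizer_data` (the inducing character dies on `w₀ N_χ w₀`)
import Summits.HodgeConjecture.HodgeConjecture.Theorems.K2LiuSiegelUnipotentCharacters         -- ★ `toBlocks₁₂_blk_mul`, `toBlocks₁₂_blk_inv`
import HarnessLib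

/-!
# Crux `HLiu418`, KIND 1, (K1b-W) route step (c″): `f (w₀ · u · x)` depends on `u ∈ N_Δ(𝔸)` only through the corner coordinate `X(u)₁₁`

Cell `hodgecm-mathlib`, crux item hLiu418 = `stmt-HodgeConjecture-24832` (helper lane, count-neutral); squad K2 ∕ K2Liu, LEAD F0P6-plan (g14); prover F0P2-p11 (g2).
THEOREMS ONLY (no `def`, no `instance`, no notation, no named-fact hypothesis, no `sorry`).

WHY (memo ADDENDUM 2).  In the translate reduction of the K1-b♮ line term, `n₂ t · Λ b = Λ b · (Λb⁻¹ n₂ t Λb)` and the conjugated unipotent has corner coordinate `b⁻¹ X b♯`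
(★ `deltaBlock_mul_toBlocks₁₂_conj`) — a rescaled corner line PLUS an `N_χ(𝔸)`-part.  This file shows the `N_χ`-part is invisible behind `w₀`:
* §1 **`apply_reflStd_mul_of_stabilizer`** — for `z ∈ N_Δ(𝔸)` with `w₀ z w₀ ∈ P_Δ(𝔸)` and a Siegel section `f ∈ I_Δ(s, χ)`: `f (w₀ · (z · x)) = f (w₀ · x)` (the inducing character
  dies there, ★ `reflection_stabilizer_data`; this is ★ p861153's internal step `hfZ`, now named).
* §2 **`isSiegelDelta_reflStd_conj_unip_iff_corner`** — `w₀ z w₀ ∈ P_Δ(𝔸) ⟺ X(z)₁₁ = 0` (★ `isSiegelDelta_reflStd_conj_levi_unip_iff` at `x = 1`).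
* §3 **`apply_reflStd_unip_congr`** — `u, u' ∈ N_Δ(𝔸)`, `X(u)₁₁ = X(u')₁₁` ⟹ `f (w₀ · u · x) = f (w₀ · u' · x)` (`z = u'⁻¹u ∈ N_χ`, `N_Δ` abelian).
HONEST LABEL.  Count-neutral helper; `HC_CM` is proved only modulo the 7 printed citations (2 remaining named inputs: hLiu418 = `stmt-HodgeConjecture-24832`,
h413 = `stmt-HodgeConjecture-24833`) until rung 0 closes.

## References
* [MoeglinWaldspurger1995] C. Mœglin, J.-L. Waldspurger, CUP (1995), II.1.7.
* [KudlaRallis1994] S. Kudla, S. Rallis, Ann. of Math. 140 (1994), §2 (2.10)–(2.12).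
* [GelbartPiatetskishapiroRallis1987] LNM 1254 (1987), Part A §§1–2.
-/

set_option autoImplicit false
set_option linter.dupNamespace false -- the mandated namespace repeats `HodgeConjecture.HodgeConjecture`

noncomputable section

open scoped Matrix
open NumberField IsDedekindDomain
open Literature.NumberTheory.Automorphic Literature.NumberTheory.Automorphic.UnitaryGroup Literature.NumberTheory.GaloisRepresentations
open Literature.NumberTheory.GelbartRogawski1991 Literature.NumberTheory.GelbartRogawski1991.GRConstruction
open Literature.NumberTheory.GelbartRogawski1991.AdaptedBlocks
open Literature.NumberTheory.K2Lit.SiegelDoubled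
open UnitaryDualPair

namespace Summit.HodgeConjecture.HodgeConjecture.Cruxes.HLiu418.K2LiuReflStdUnipCongr

open K2LiuSiegelUnipotentFourierDefs K2LiuSiegelUnipotentCharacters K2LiuSiegelMiddleCellLeviCriterion K2LiuSiegelMiddleCellSortedPattern
  K2LiuSiegelRationalLeviDecomposition
open K2LiuSiegelMiddleStabilizerCharacter (reflection_stabilizer_data)
open K2LiuSiegelBruhatMiddleCellDelta (isSiegelDelta_conj_unip_iff iotaGG_one_mul_self)

variable (L : Type) [Field L] [NumberField L] [IsCMField L]
variable {N M : ℕ} (e : Fin N × Fin M ≃ Fin 2)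
  (dV : Fin N → L) (hdV : ∀ i, IsCMField.complexConj L (dV i) = dV i)
  (dW : Fin M → L) (hdW : ∀ i, IsCMField.complexConj L (dW i) = dW i)

variable {g₀ : UnitaryGroup.rationalPair (Fp L) L (IsCMField.complexConj L) N M (Matrix.diagonal dV) (Matrix.diagonal dW)}
  (hg₀ : ((g₀ : GL (Fin N × Fin M) L) : Matrix (Fin N × Fin M) (Fin N × Fin M) L) = Matrix.diagonal (fun k => 1 - 2 * (![0, 1] : Fin 2 → L) (e k)))
  (Λ : GL (Fin 2) (AdeleRing (𝓞 L) L) →* HA L e dV hdV dW hdW)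
  (hΛ : ∀ g : GL (Fin 2) (AdeleRing (𝓞 L) L), blk L e dV hdV dW hdW (Λ g) =
    cayR (AdeleRing (𝓞 L) L) (Fin 2) * Matrix.fromBlocks (g : Matrix (Fin 2) (Fin 2) (AdeleRing (𝓞 L) L)) 0 0
      (((gramR L e dV hdV dW hdW).map ((algebraMap L (AdeleRing (𝓞 L) L)).comp (algebraMap (Fp L) L)))⁻¹ *
        (((g⁻¹ : GL (Fin 2) (AdeleRing (𝓞 L) L)) : Matrix (Fin 2) (Fin 2) (AdeleRing (𝓞 L) L)).map
          (conjAdele (Fp L) L (IsCMField.complexConj L)))ᵀ *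
        (gramR L e dV hdV dW hdW).map ((algebraMap L (AdeleRing (𝓞 L) L)).comp (algebraMap (Fp L) L))) *
      cayRinv (AdeleRing (𝓞 L) L) (Fin 2))

/-! ## §1 The inducing character dies on the middle stabiliser -/

include hg₀ in
/-- **`f (w₀ · (z · x)) = f (w₀ · x)`** for `z ∈ N_Δ(𝔸)` with `w₀ z w₀ ∈ P_Δ(𝔸)` and a Siegel section `f ∈ I_Δ(s, χ)` (★ `reflection_stabilizer_data`: the conjugate lies in `P_Δ(𝔸)` with
trivial inducing character; `w₀² = 1`). [cite: MoeglinWaldspurger1995, II.1.7] [cite: KudlaRallis1994, §2 (2.10)–(2.12)] -/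
theorem apply_reflStd_mul_of_stabilizer {χ : HeckeCharacter L} {s : ℂ} {f : HA L e dV hdV dW hdW → ℂ} (hf : IsSiegelDeltaSection L e dV hdV dW hdW χ s f)
    {z : HA L e dV hdV dW hdW} (hz : z ∈ unipDelta L e dV hdV dW hdW)
    (hzP : IsSiegelDelta L e dV hdV dW hdW
      (iotaGG L e dV hdV dW hdW (1, UnitaryGroup.rationalPairToAdelic (Fp L) L (IsCMField.complexConj L) N M (Matrix.diagonal dV) (Matrix.diagonal dW) g₀) * z *
        iotaGG L e dV hdV dW hdW (1, UnitaryGroup.rationalPairToAdelic (Fp L) L (IsCMField.complexConj L) N M (Matrix.diagonal dV) (Matrix.diagonal dW) g₀)))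
    (x : HA L e dV hdV dW hdW) :
    f (iotaGG L e dV hdV dW hdW (1, UnitaryGroup.rationalPairToAdelic (Fp L) L (IsCMField.complexConj L) N M (Matrix.diagonal dV) (Matrix.diagonal dW) g₀) * (z * x)) =
      f (iotaGG L e dV hdV dW hdW (1, UnitaryGroup.rationalPairToAdelic (Fp L) L (IsCMField.complexConj L) N M (Matrix.diagonal dV) (Matrix.diagonal dW) g₀) * x) := by
  have hgg : UnitaryGroup.rationalPairToAdelic (Fp L) L (IsCMField.complexConj L) N M (Matrix.diagonal dV) (Matrix.diagonal dW) g₀ *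
      UnitaryGroup.rationalPairToAdelic (Fp L) L (IsCMField.complexConj L) N M (Matrix.diagonal dV) (Matrix.diagonal dW) g₀ = 1 := by
    rw [← map_mul, mul_self_of_coe_eq_signDiagonal L e dV dW (pattern_std L) hg₀, map_one]
  have hw₀inv := reflStd_inv L e dV hdV dW hdW hg₀
  have hX := (isSiegelDelta_conj_unip_iff L e dV hdV dW hdW hgg hz).1 hzP
  obtain ⟨hP, hσ⟩ := reflection_stabilizer_data L e dV hdV dW hdW χ s hgg hz hX
  rw [show iotaGG L e dV hdV dW hdW (1, UnitaryGroup.rationalPairToAdelic (Fp L) L (IsCMField.complexConj L) N M (Matrix.diagonal dV) (Matrix.diagonal dW) g₀) * (z * x) =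
      iotaGG L e dV hdV dW hdW (1, UnitaryGroup.rationalPairToAdelic (Fp L) L (IsCMField.complexConj L) N M (Matrix.diagonal dV) (Matrix.diagonal dW) g₀) * z *
        (iotaGG L e dV hdV dW hdW (1, UnitaryGroup.rationalPairToAdelic (Fp L) L (IsCMField.complexConj L) N M (Matrix.diagonal dV) (Matrix.diagonal dW) g₀))⁻¹ *
        (iotaGG L e dV hdV dW hdW (1, UnitaryGroup.rationalPairToAdelic (Fp L) L (IsCMField.complexConj L) N M (Matrix.diagonal dV) (Matrix.diagonal dW) g₀) * x) by group,
    hf _ hP, hσ, one_mul]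

/-! ## §2 The middle stabiliser in `N_Δ(𝔸)` is the corner kernel -/

include hg₀ hΛ in
/-- **`w₀ z w₀ ∈ P_Δ(𝔸) ⟺ X(z)₁₁ = 0`** for `z ∈ N_Δ(𝔸)` (★ `isSiegelDelta_reflStd_conj_levi_unip_iff` at `x = 1`). [cite: MoeglinWaldspurger1995, II.1.7] -/
theorem isSiegelDelta_reflStd_conj_unip_iff_corner {z : HA L e dV hdV dW hdW} (hz : z ∈ unipDelta L e dV hdV dW hdW) :
    IsSiegelDelta L e dV hdV dW hdW
        (iotaGG L e dV hdV dW hdW (1, UnitaryGroup.rationalPairToAdelic (Fp L) L (IsCMField.complexConj L) N M (Matrix.diagonal dV) (Matrix.diagonal dW) g₀) * z *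
          iotaGG L e dV hdV dW hdW (1, UnitaryGroup.rationalPairToAdelic (Fp L) L (IsCMField.complexConj L) N M (Matrix.diagonal dV) (Matrix.diagonal dW) g₀)) ↔
      (blk L e dV hdV dW hdW z).toBlocks₁₂ 1 1 = 0 := by
  have h := isSiegelDelta_reflStd_conj_levi_unip_iff L e dV hdV dW hdW hg₀ Λ hΛ 1 hz
  rw [map_one, one_mul] at h
  rw [h]
  obtain ⟨t, ht⟩ := exists_gramR_eq_diagonal L e dV hdV dW hdW
  constructor
  · rintro ⟨-, h2⟩
    rwa [Units.val_one, Matrix.one_mul] at h2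
  · intro h'
    refine ⟨⟨?_, ?_⟩, ?_⟩
    · rw [Units.val_one, Matrix.one_apply_ne (by decide)]
    · rw [ht, Matrix.diagonal_map (map_zero _), Matrix.inv_diagonal, Matrix.mul_diagonal, Matrix.diagonal_mul, Matrix.transpose_apply, Matrix.map_apply,
        inv_one, Units.val_one, Matrix.one_apply_ne (by decide), map_zero, mul_zero, zero_mul]
    · rwa [Units.val_one, Matrix.one_mul]

/-! ## §3 Same corner coordinate, same value behind `w₀` -/

include hg₀ hΛ in
/-- **`X(u)₁₁ = X(u')₁₁ ⟹ f (w₀ · u · x) = f (w₀ · u' · x)`** for `u, u' ∈ N_Δ(𝔸)` and a Siegel section `f ∈ I_Δ(s, χ)`: `z = u'⁻¹ u` has corner coordinate `0` (★ `toBlocks₁₂_blk_mul ∕ _inv`),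
so `w₀ z w₀ ∈ P_Δ(𝔸)` (§2) with trivial character (§1), and `N_Δ(𝔸)` is abelian. [cite: MoeglinWaldspurger1995, II.1.7] [cite: KudlaRallis1994, §2 (2.10)–(2.12)] -/
theorem apply_reflStd_unip_congr {χ : HeckeCharacter L} {s : ℂ} {f : HA L e dV hdV dW hdW → ℂ} (hf : IsSiegelDeltaSection L e dV hdV dW hdW χ s f)
    {u u' : HA L e dV hdV dW hdW} (hu : u ∈ unipDelta L e dV hdV dW hdW) (hu' : u' ∈ unipDelta L e dV hdV dW hdW)
    (h11 : (blk L e dV hdV dW hdW u).toBlocks₁₂ 1 1 = (blk L e dV hdV dW hdW u').toBlocks₁₂ 1 1) (x : HA L e dV hdV dW hdW) :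
    f (iotaGG L e dV hdV dW hdW (1, UnitaryGroup.rationalPairToAdelic (Fp L) L (IsCMField.complexConj L) N M (Matrix.diagonal dV) (Matrix.diagonal dW) g₀) * u * x) =
      f (iotaGG L e dV hdV dW hdW (1, UnitaryGroup.rationalPairToAdelic (Fp L) L (IsCMField.complexConj L) N M (Matrix.diagonal dV) (Matrix.diagonal dW) g₀) * u' * x) := by
  have hz : u'⁻¹ * u ∈ unipDelta L e dV hdV dW hdW := mul_mem (inv_mem hu') hu
  have hX : (blk L e dV hdV dW hdW (u'⁻¹ * u)).toBlocks₁₂ 1 1 = 0 := by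
    rw [toBlocks₁₂_blk_mul L e dV hdV dW hdW (inv_mem hu') hu, toBlocks₁₂_blk_inv L e dV hdV dW hdW hu', Matrix.add_apply, Matrix.neg_apply, h11,
      neg_add_cancel]
  have hzP := (isSiegelDelta_reflStd_conj_unip_iff_corner L e dV hdV dW hdW hg₀ Λ hΛ hz).2 hX
  have hu_eq : u = u'⁻¹ * u * u' := by
    rw [← mul_comm_of_mem_unipDelta L e dV hdV dW hdW hu' hz, mul_inv_cancel_left]
  conv_lhs => rw [hu_eq]
  rw [mul_assoc _ (u'⁻¹ * u * u') x, mul_assoc (u'⁻¹ * u) u' x, apply_reflStd_mul_of_stabilizer L e dV hdV dW hdW hg₀ hf hz hzP (u' * x), mul_assoc]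

end Summit.HodgeConjecture.HodgeConjecture.Cruxes.HLiu418.K2LiuReflStdUnipCongr

end
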